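import Summits.Ventures.HodgeRepro2.T5SU11SphericalLegendreAll
import Summits.Ventures.HodgeRepro2.T5SU11SphericalCfunClosed

/-!
# Harish-Chandra's `c`-function at the even negative integers is the central binomial coefficient over `4ⁿ`:
`c(−2n) = (2n)!/(4ⁿ n!²)`, and `e^{−2nt} P_n(cosh 2t) → (2n)!/(4ⁿ n!²)`

The closed form `c(λ) = Γ((1 − λ)/2)/(√π Γ(1 − λ/2))` (`T5SU11SphericalCfunClosed.cfun_eq_gamma`) at `λ = −2n` is
`Γ(n + ½)/(√π n!)`, and Legendre's duplication formula (Mathlib's `Real.Gamma_mul_Gamma_add_half` at `s = n + ½`) gives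
**`Γ(n + ½) = (2n)! √π/(4ⁿ n!)`** (`Gamma_nat_add_half`), hence

  **`c(−2n) = (2n)!/(4ⁿ n!²) = C(2n, n)/4ⁿ`**   (`cfun_neg_two_mul`; `n = 1`: `c(−2) = 1/2`, `cfun_neg_two_of_legendre`).

Since `φ_{−2n}(a_t) = P_n(cosh 2t)` (`T5SU11SphericalLegendreAll.sph_neg_even_hyp`) and `e^{λt} φ_λ(a_t) → c(λ)` for `λ < 1`
(`T5SU11SphericalAsymptotic.tendsto_exp_mul_sph_hyp`), this is the leading asymptotics of the Legendre polynomials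
along `cosh 2t → ∞`:

  **`e^{−2nt} P_n(cosh 2t) → (2n)!/(4ⁿ n!²)`**   (`tendsto_exp_neg_mul_legP_cosh`)

— i.e. `P_n(x) ~ ((2n)!/(2ⁿ n!²)) xⁿ` as `x → ∞` (`cosh 2t ~ e^{2t}/2`), the classical leading coefficient of `P_n`,
here obtained from the `c`-function of `SU(1,1)`. Nothing is claimed about (N).

Blind lane: Mathlib + the HodgeRepro2 prefix only; no sorry; axioms ⊆ {propext, Classical.choice,
Quot.sound}.
-/

namespace Summit.Ventures.HodgeRepro2.T5SU11SphericalLegendreCfun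

open MeasureTheory Metric Set Filter Topology
open T5SU11Unimodular T5SU11Cartan T5SU11OneParameter T5SU11CartanProjection T5BergmanCoefficient
  T5SU11SphericalFunction T5SU11SphericalSymmetry T5SU11SphericalAsymptotic T5SU11SphericalCfun
  T5SU11SphericalCfunClosed T5SU11SphericalLegendreAll
open scoped Real

/-! ### `Γ(n + ½)` by the duplication formula -/

/-- **`Γ(n + ½) = (2n)! √π/(4ⁿ n!)`** (Legendre's duplication formula at `s = n + ½`). -/
theorem Gamma_nat_add_half (n : ℕ) :
    Real.Gamma ((n : ℝ) + 1 / 2) = ((2 * n).factorial : ℝ) * √π / (4 ^ n * (n.factorial : ℝ)) := by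
  have h := Real.Gamma_mul_Gamma_add_half ((n : ℝ) + 1 / 2)
  rw [show (n : ℝ) + 1 / 2 + 1 / 2 = ((n : ℕ) : ℝ) + 1 by ring, Real.Gamma_nat_eq_factorial,
    show 2 * ((n : ℝ) + 1 / 2) = ((2 * n : ℕ) : ℝ) + 1 by push_cast; ring, Real.Gamma_nat_eq_factorial,
    show (1 : ℝ) - (((2 * n : ℕ) : ℝ) + 1) = -((2 * n : ℕ) : ℝ) by ring, Real.rpow_neg (by norm_num),
    Real.rpow_natCast, pow_mul, show (2 : ℝ) ^ 2 = 4 by norm_num] at h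
  have hf : (0 : ℝ) < n.factorial := by exact_mod_cast Nat.factorial_pos n
  have h4 : (0 : ℝ) < 4 ^ n := by positivity
  rw [eq_div_iff (by positivity)]
  calc Real.Gamma ((n : ℝ) + 1 / 2) * (4 ^ n * (n.factorial : ℝ))
      = (Real.Gamma ((n : ℝ) + 1 / 2) * (n.factorial : ℝ)) * 4 ^ n := by ring
    _ = ((2 * n).factorial : ℝ) * (4 ^ n)⁻¹ * √π * 4 ^ n := by rw [h]
    _ = ((2 * n).factorial : ℝ) * √π := by field_simp

/-! ### The `c`-function at `−2n` -/

/-- **`c(−2n) = (2n)!/(4ⁿ n!²)`** for every `n`. -/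
theorem cfun_neg_two_mul (n : ℕ) :
    cfun (-(2 * (n : ℝ))) = ((2 * n).factorial : ℝ) / (4 ^ n * ((n.factorial : ℝ)) ^ 2) := by
  have hn : (0 : ℝ) ≤ n := Nat.cast_nonneg n
  rw [cfun_eq_gamma (by linarith), show (1 - -(2 * (n : ℝ))) / 2 = (n : ℝ) + 1 / 2 by ring,
    show 1 - -(2 * (n : ℝ)) / 2 = ((n : ℕ) : ℝ) + 1 by ring, Real.Gamma_nat_eq_factorial, Gamma_nat_add_half]
  have hs : 0 < √π := Real.sqrt_pos.mpr Real.pi_pos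
  have hf : (0 : ℝ) < n.factorial := by exact_mod_cast Nat.factorial_pos n
  field_simp

/-- The cross-check `n = 1`: `c(−2) = 1/2` (`T5SU11SphericalCfunClosed.cfun_neg_two`). -/
theorem cfun_neg_two_of_legendre : cfun (-2) = 1 / 2 := by
  have h := cfun_neg_two_mul 1
  norm_num [Nat.factorial] at h
  exact h

section measure

variable [MeasurableSpace Circle] [BorelSpace Circle]

/-- **The leading asymptotics of the Legendre polynomials along `cosh 2t`**:
`e^{−2nt} P_n(cosh 2t) → (2n)!/(4ⁿ n!²)` as `t → ∞` — the `c`-function of `SU(1,1)` at `λ = −2n`. -/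
theorem tendsto_exp_neg_mul_legP_cosh (n : ℕ) :
    Tendsto (fun t : ℝ => Real.exp (-(2 * (n : ℝ)) * t) * legP n (Real.cosh (2 * t))) atTop
      (𝓝 (((2 * n).factorial : ℝ) / (4 ^ n * ((n.factorial : ℝ)) ^ 2))) := by
  have hn : (0 : ℝ) ≤ n := Nat.cast_nonneg n
  have h := tendsto_exp_mul_sph_hyp (lam := -(2 * (n : ℝ))) (by linarith)
  rw [cfun_neg_two_mul] at h
  refine h.congr fun t => ?_
  rw [sph_neg_even_hyp]

end measure

end Summit.Ventures.HodgeRepro2.T5SU11SphericalLegendreCfun
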